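import Summits.CriticalPhenomena.PercolationContinuityZ3.Theorems.FK.IsingMagnetizationCLT
import Literature.Probability.LatticeModels.IsingLowTemperatureTruncatedDecay
import HarnessLib

/-!
# NEWMAN'S CLT FOR THE MAGNETISATION IN THE PLUS PHASE OF THE ISING MODEL:
# `(M_n − |Λ_n| m*(β))/√|Λ_n| ⇒ N(0, χ⁺(β))` AT LOW TEMPERATURE (`β ≥ β₀(d)`, `d ≥ 2`, UNCONDITIONAL) AND FOR ALL `β > β_c(d)`,
# `d ≥ 3`, GIVEN DUMINIL-COPIN–GOSWAMI–RAOUFI 2020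

Claimed R42 (8)(c) in the cell INBOX at 2026-08-28T18:06:48Z by fkp-10a gen 355 (NEW CLAIM #1 of the gen), addressed to coordinator fk-4 (next seated gen; none seated since gen 275's closing line l.8493, (ι) in force for windows); lineage row FO-10a-g355 (self-suggested), package g355-isingclt, label IM-C.
Helper file of the `fk-continuity` build cell (bschramm lane; `--supports stmt-CriticalPhenomena-4575`); builds on
p205010 (kernel theorem, internal audit signed; external expert review pending). No definitions, no sorries;
standard axioms.

Newman 1980, §1: in the `+` state of an Ising ferromagnet Theorem 2 gives the CLT for the block magnetisations
"whenever the susceptibility `χ = Σ_x ⟨σ_0; σ_x⟩` is finite". Inputs, all tree theorems: (A) FKG of the plus state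
(`isPositivelyAssociated_of_spinCorr_eq_plusCorr`, `IsingStateFKG`); (B) translation invariance (`plusCorr_map_shift`,
Friedli–Velenik Thm. 3.17); the generic CLT `tendstoInDistribution_boxSpinSum_of_summable` (`IsingMagnetizationCLT`);
and for (D):

* LOW TEMPERATURE, UNCONDITIONAL: the tree's PROVED Friedli–Velenik Thm. 5.16 by the contour cluster expansion,
  `LTContour.plusCorr_truncated_le_exp`: for `d ≥ 2`, `β ≥ ltBeta d = 1 + log(2(6d+1)²)`,
  `0 ≤ ⟨σ_0σ_z⟩⁺_β − ⟨σ_0⟩⁺_β⟨σ_z⟩⁺_β ≤ e^{−(β/2)‖z‖_∞}` — summable (`summable_plusTruncated_of_ltBeta_le`);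
* THE WHOLE ORDERED PHASE `β > β_c(d)`, `d ≥ 3`: CONDITIONAL on the tree's NAMED FACT
  `DuminilCopinGoswamiRaoufi2020_truncatedTwoPointPlus_expDecay d` (Duminil-Copin–Goswami–Raoufi 2020, Thm. 1.1,
  not proved in the tree) — the theorems carrying the hypothesis `hDGR` are `conditional-result`s.

Main statements (`μ` = the plus state: the probability measure with `∫ σ_A dμ = plusCorr d β h A`, which exists and is
unique — `exists_plusMeasure_holds`, `measure_eq_of_forall_spinCorr_eq`; `m*(β) = ⟨σ_0⟩⁺_{β,0} =
spontaneousMagnetization d β`; `χ⁺ = Σ_z (⟨σ_0σ_z⟩⁺ − ⟨σ_0⟩⁺⟨σ_z⟩⁺)`):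

* `covariance_spinAt_eq_plusTruncated` — `Cov⁺(σ_x, σ_y) = ⟨σ_0σ_{y−x}⟩⁺_{β,h} − ⟨σ_0⟩⁺⟨σ_{y−x}⟩⁺` (every `h`);
* `integral_boxSpinSum_eq_card_mul_spontaneousMagnetization` — `E⁺_β M_n = |Λ_n| m*(β)`;
* `tendstoInDistribution_magnetization_plus_of_summable` — plus state at `(β, h)`, `β ≥ 0`, with summable truncated
  two-point function: `(M_n − E M_n)/√|Λ_n| ⇒ N(0, χ⁺)`;
* `variance_spinAt_le_tsum_plusTruncated` — `χ⁺ ≥ Var⁺(σ_0) = 1 − m²` (all terms `≥ 0` by FKG);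
* **`tendstoInDistribution_magnetization_plus_of_ltBeta_le`** — `d ≥ 2`, `β ≥ ltBeta d`:
  `(M_n − |Λ_n| m*(β))/√|Λ_n| ⇒ N(0, χ⁺(β))`, UNCONDITIONAL;
* **`tendstoInDistribution_magnetization_plus_of_criticalBeta_lt`** — `d ≥ 3`, `β > β_c(d)`, the same conclusion
  GIVEN `DuminilCopinGoswamiRaoufi2020_truncatedTwoPointPlus_expDecay d` (CONDITIONAL).

## References

* C. M. Newman, Comm. Math. Phys. 74 (1980) 119–128, Thm. 2 and §1. [Newman1980]
* R. S. Ellis, *Entropy, Large Deviations, and Statistical Mechanics*, Springer 2006, §V.7, Thm. V.7.2. [Ellis2006]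
* S. Friedli, Y. Velenik, *Statistical Mechanics of Lattice Systems*, CUP 2017, Thm. 3.17, Thm. 3.21, Thm. 5.16
  (low-temperature exponential decay of truncated correlations). [FriedliVelenik2017]
* H. Duminil-Copin, S. Goswami, A. Raoufi, Comm. Math. Phys. 374 (2020) 891–921, Thm. 1.1. [DuminilCopinGoswamiRaoufi2020]
-/

noncomputable section

namespace Summit.CriticalPhenomena.PercolationContinuityZ3.Theorems.FK

namespace IsingCLT

open MeasureTheory ProbabilityTheory Filter Topology Finset
open scoped symmDiff
open Literature.Probability.Percolation Literature.Probability.LatticeModels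
open Summit.CriticalPhenomena.PercolationContinuityZ3.Theorems.FK.NewmanCLT

variable {d : ℕ}

/-! ### The plus state: translation invariance, one- and two-point integrals -/

section Plus

variable {β h : ℝ} {μ : Measure (SpinConfig (Site d))} [IsProbabilityMeasure μ]

/-- **The plus state is translation invariant** (Friedli–Velenik 2017, Thm. 3.17 (2) / Example 6.51; `β ≥ 0`, every
`h`): the probability measure with correlations `plusCorr d β h`. [cite: FriedliVelenik2017, Thm. 3.17 (2) and Example 6.51] -/
theorem isTranslationInvariantMeasure_of_spinCorr_eq_plusCorr (hβ : 0 ≤ β)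
    (hμ : ∀ A : Finset (Site d), spinCorr μ A = plusCorr d β h A) : IsTranslationInvariantMeasure μ :=
  isTranslationInvariantMeasure_of_spinCorr_eq (fun B v => plusCorr_map_shift hβ h B v) μ hμ

/-- `⟨σ_x⟩⁺_{β,h} = ⟨σ_0⟩⁺_{β,h}` (translation invariance of the plus state). [cite: FriedliVelenik2017, Thm. 3.17 (2)] -/
theorem plusCorr_singleton_eq (hβ : 0 ≤ β) (h : ℝ) (x : Site d) : plusCorr d β h {x} = plusCorr d β h {0} := by
  have key := plusCorr_map_shift hβ h ({0} : Finset (Site d)) x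
  rw [Finset.map_singleton] at key
  simpa using key

omit [IsProbabilityMeasure μ] in
/-- `∫ σ_x dμ = ⟨σ_0⟩⁺_{β,h}` in the plus state. [cite: FriedliVelenik2017, Thm. 3.17] -/
theorem integral_spinAt_eq_plusCorr (hβ : 0 ≤ β) (hμ : ∀ A : Finset (Site d), spinCorr μ A = plusCorr d β h A)
    (x : Site d) : ∫ σ, spinAt x σ ∂μ = plusCorr d β h {0} := by
  have hx := hμ {x}
  rw [spinCorr, spinProduct_singleton] at hx
  rw [hx, plusCorr_singleton_eq hβ h x]

omit [IsProbabilityMeasure μ] in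
/-- `∫ σ_0 σ_z dμ = ⟨σ_{{0}∆{z}}⟩⁺_{β,h}` in the plus state (`σ_0σ_z = σ_{{0}∆{z}}`, `= 1` on the diagonal).
[cite: FriedliVelenik2017, Thm. 3.17] -/
theorem integral_spinAt_mul_spinAt_eq_plusCorr (hμ : ∀ A : Finset (Site d), spinCorr μ A = plusCorr d β h A)
    (z : Site d) : ∫ σ, spinAt 0 σ * spinAt z σ ∂μ = plusCorr d β h ({0} ∆ {z}) := by
  classical
  have h1 : (fun σ => spinAt (0 : Site d) σ * spinAt z σ) = spinProduct (({0} : Finset (Site d)) ∆ {z}) := by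
    rw [← spinPair_eq_spinProduct_symmDiff]; rfl
  rw [h1]
  exact hμ _

/-- **`Cov⁺(σ_x, σ_y) = ⟨σ_0σ_{y−x}⟩⁺ − ⟨σ_0⟩⁺⟨σ_{y−x}⟩⁺`**: in the plus state (`β ≥ 0`, every `h`) the spin covariances
are the truncated plus two-point function (translation invariance). [cite: Newman1980, Thm. 2 (B); FriedliVelenik2017, Thm. 3.17] -/
theorem covariance_spinAt_eq_plusTruncated (hβ : 0 ≤ β) (hμ : ∀ A : Finset (Site d), spinCorr μ A = plusCorr d β h A)
    (x y : Site d) : cov[spinAt x, spinAt y; μ] =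
      plusCorr d β h ({0} ∆ {y - x}) - plusCorr d β h {0} * plusCorr d β h {y - x} := by
  rw [covariance_spinAt_eq_of_isTranslationInvariant (isTranslationInvariantMeasure_of_spinCorr_eq_plusCorr hβ hμ) x y,
    covariance_eq_sub (memLp_spinAt μ 0 2) (memLp_spinAt μ (y - x) 2)]
  simp only [Pi.mul_apply, integral_spinAt_eq_plusCorr hβ hμ, integral_spinAt_mul_spinAt_eq_plusCorr hμ,
    plusCorr_singleton_eq hβ h (y - x)]

/-- **`E⁺ M_n = |Λ_n| ⟨σ_0⟩⁺_{β,h}`**. [cite: FriedliVelenik2017, Thm. 3.17] -/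
theorem integral_boxSpinSum_eq_card_mul_plusCorr (hβ : 0 ≤ β)
    (hμ : ∀ A : Finset (Site d), spinCorr μ A = plusCorr d β h A) (n : ℕ) :
    ∫ σ, ∑ z ∈ box d n, spinAt z σ ∂μ = #(box d n) * plusCorr d β h {0} := by
  rw [integral_finsetSum _ fun z _ => integrable_of_abs_le (measurable_spinAt z) (abs_spinAt_le_one z)]
  simp only [integral_spinAt_eq_plusCorr hβ hμ, Finset.sum_const, nsmul_eq_mul]

/-- **`E⁺_β M_n = |Λ_n| m*(β)`** at `h = 0` (`m*(β) = ⟨σ_0⟩⁺_{β,0}`, the tree's `spontaneousMagnetization_eq_plusCorr`).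
[cite: FriedliVelenik2017, §3.7, eq. (3.41)] -/
theorem integral_boxSpinSum_eq_card_mul_spontaneousMagnetization (hβ : 0 ≤ β)
    (hμ : ∀ A : Finset (Site d), spinCorr μ A = plusCorr d β 0 A) (n : ℕ) :
    ∫ σ, ∑ z ∈ box d n, spinAt z σ ∂μ = #(box d n) * spontaneousMagnetization d β := by
  rw [integral_boxSpinSum_eq_card_mul_plusCorr hβ hμ, spontaneousMagnetization_eq_plusCorr]

/-! ### The CLT in the plus state whenever the susceptibility is finite -/

/-- **NEWMAN'S CLT IN THE PLUS STATE, general field** (Newman 1980, Thm. 2, §1): for `β ≥ 0`, any `h`, and the plus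
state `μ` (`∫ σ_A dμ = ⟨σ_A⟩⁺_{β,h}`), if the truncated two-point function
`z ↦ ⟨σ_0σ_z⟩⁺ − ⟨σ_0⟩⁺⟨σ_z⟩⁺` is summable (`χ⁺ < ∞`), then `(M_n − |Λ_n|⟨σ_0⟩⁺)/√|Λ_n| ⇒ N(0, χ⁺)` — Ellis 2006,
Thm. V.7.2 (a) for the plus state. [cite: Newman1980, Thm. 2; Ellis2006, Thm. V.7.2] -/
theorem tendstoInDistribution_magnetization_plus_of_summable {Ω' : Type*} {mΩ' : MeasurableSpace Ω'}
    {P' : Measure Ω'} [IsProbabilityMeasure P'] {Y : Ω' → ℝ} (hd : 1 ≤ d) (hβ : 0 ≤ β)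
    (hμ : ∀ A : Finset (Site d), spinCorr μ A = plusCorr d β h A)
    (hsum : Summable fun z : Site d => plusCorr d β h ({0} ∆ {z}) - plusCorr d β h {0} * plusCorr d β h {z})
    {v : NNReal} (hv : (v : ℝ) = ∑' z : Site d, (plusCorr d β h ({0} ∆ {z}) - plusCorr d β h {0} * plusCorr d β h {z}))
    (hY : HasLaw Y (gaussianReal 0 v) P') :
    TendstoInDistribution (fun (n : ℕ) (σ : SpinConfig (Site d)) => (Real.sqrt #(box d n))⁻¹ *
        (∑ z ∈ box d n, spinAt z σ - #(box d n) * plusCorr d β h {0})) atTop Y (fun _ => μ) P' := by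
  have hcov : ∀ z : Site d, cov[spinAt 0, spinAt z; μ] =
      plusCorr d β h ({0} ∆ {z}) - plusCorr d β h {0} * plusCorr d β h {z} := fun z => by
    rw [covariance_spinAt_eq_plusTruncated hβ hμ 0 z, sub_zero]
  have hsum' : Summable fun z : Site d => cov[spinAt 0, spinAt z; μ] := by simp_rw [hcov]; exact hsum
  have hv' : (v : ℝ) = ∑' z : Site d, cov[spinAt 0, spinAt z; μ] := by simp_rw [hcov]; exact hv
  have key := tendstoInDistribution_boxSpinSum_of_summable hd (isPositivelyAssociated_of_spinCorr_eq_plusCorr hβ h μ hμ)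
    (isTranslationInvariantMeasure_of_spinCorr_eq_plusCorr hβ hμ) hsum' hv' hY
  simp only [integral_boxSpinSum_eq_card_mul_plusCorr hβ hμ] at key
  exact key

/-- **Non-degeneracy bound `χ⁺ ≥ Var⁺(σ_0) = 1 − ⟨σ_0⟩²`**: every term of the susceptibility series is a covariance of
increasing functions, hence `≥ 0` (FKG), and the `z = 0` term is the variance of one spin.
[cite: Newman1980, (10) and (13)] -/
theorem one_sub_sq_le_tsum_plusTruncated (hβ : 0 ≤ β) (hμ : ∀ A : Finset (Site d), spinCorr μ A = plusCorr d β h A)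
    (hsum : Summable fun z : Site d => plusCorr d β h ({0} ∆ {z}) - plusCorr d β h {0} * plusCorr d β h {z}) :
    1 - plusCorr d β h {0} ^ 2 ≤
      ∑' z : Site d, (plusCorr d β h ({0} ∆ {z}) - plusCorr d β h {0} * plusCorr d β h {z}) := by
  classical
  have hcov : ∀ z : Site d, cov[spinAt 0, spinAt z; μ] =
      plusCorr d β h ({0} ∆ {z}) - plusCorr d β h {0} * plusCorr d β h {z} := fun z => by
    rw [covariance_spinAt_eq_plusTruncated hβ hμ 0 z, sub_zero]
  have h0 : ∀ z : Site d, 0 ≤ plusCorr d β h ({0} ∆ {z}) - plusCorr d β h {0} * plusCorr d β h {z} := fun z => by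
    rw [← hcov z]
    exact covariance_nonneg_of_monotone (isPositivelyAssociated_of_spinCorr_eq_plusCorr hβ h μ hμ) (spinAt_mono 0)
      (spinAt_mono z) (measurable_spinAt 0) (measurable_spinAt z) ⟨1, abs_spinAt_le_one 0⟩ ⟨1, abs_spinAt_le_one z⟩
  have hz : plusCorr d β h (({0} : Finset (Site d)) ∆ {(0 : Site d)}) - plusCorr d β h {0} * plusCorr d β h {0} =
      1 - plusCorr d β h {0} ^ 2 := by
    rw [symmDiff_self, Finset.bot_eq_empty, sq]
    have h1 := hμ ∅
    rw [spinCorr] at h1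
    simp only [spinProduct, Finset.prod_empty, integral_const, probReal_univ, smul_eq_mul, mul_one] at h1
    rw [← h1]
  rw [← hz]
  exact hsum.le_tsum 0 fun z _ => h0 z

end Plus

/-! ### (D) Finite susceptibility in the plus phase -/

/-- **Low temperature: `χ⁺(β) < ∞` for `β ≥ ltBeta d`, `d ≥ 2`** — Friedli–Velenik 2017, Thm. 5.16 (the tree's
PROVED contour cluster expansion `LTContour.plusCorr_truncated_le_exp`: `0 ≤ ⟨σ_0;σ_z⟩⁺_β ≤ e^{−(β/2)‖z‖_∞}`).
[cite: FriedliVelenik2017, Thm. 5.16] -/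
theorem summable_plusTruncated_of_ltBeta_le (hd : 2 ≤ d) {β : ℝ} (hβ : LTContour.ltBeta d ≤ β) :
    Summable fun z : Site d => plusCorr d β 0 ({0} ∆ {z}) - plusCorr d β 0 {0} * plusCorr d β 0 {z} := by
  haveI : NeZero d := ⟨by omega⟩
  have hβ0 : 0 < β / 2 := by have := LTContour.one_le_ltBeta d; linarith
  obtain ⟨B, hB⟩ := sum_box_exp_neg_mul_norm_le (d := d) hβ0
  have h0 : ∀ z : Site d, 0 ≤ plusCorr d β 0 ({0} ∆ {z}) - plusCorr d β 0 {0} * plusCorr d β 0 {z} := fun z =>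
    (LTContour.plusCorr_truncated_le_exp hd hβ 0 z).1
  refine summable_of_sum_le (c := B) h0 fun s => ?_
  obtain ⟨N, hN⟩ := exists_forall_subset_box d s
  refine (Finset.sum_le_sum_of_subset_of_nonneg (hN N le_rfl) fun x _ _ => h0 x).trans ?_
  refine (Finset.sum_le_sum fun z _ => (LTContour.plusCorr_truncated_le_exp hd hβ 0 z).2).trans ?_
  refine le_of_eq_of_le (Finset.sum_congr rfl fun z _ => ?_) (hB N)
  rw [zero_sub, norm_neg, neg_mul]

/-- **The whole ordered phase, `d ≥ 3`: `χ⁺(β) < ∞` for every `β > β_c(d)` GIVEN Duminil-Copin–Goswami–Raoufi 2020,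
Thm. 1.1** (the tree's named fact `DuminilCopinGoswamiRaoufi2020_truncatedTwoPointPlus_expDecay d`, taken as a
hypothesis — CONDITIONAL). [cite: DuminilCopinGoswamiRaoufi2020, Thm 1.1] -/
theorem summable_plusTruncated_of_criticalBeta_lt
    (hDGR : DuminilCopinGoswamiRaoufi2020_truncatedTwoPointPlus_expDecay d) (hd : 3 ≤ d) {β : ℝ}
    (hβc : criticalBeta d < β) :
    Summable fun z : Site d => plusCorr d β 0 ({0} ∆ {z}) - plusCorr d β 0 {0} * plusCorr d β 0 {z} := by
  obtain ⟨c, hc, hdec⟩ := hDGR hd β hβc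
  obtain ⟨B, hB⟩ := sum_box_exp_neg_mul_norm_le (d := d) hc
  have h0 : ∀ z : Site d, 0 ≤ plusCorr d β 0 ({0} ∆ {z}) - plusCorr d β 0 {0} * plusCorr d β 0 {z} := fun z =>
    (hdec 0 z).1
  refine summable_of_sum_le (c := B) h0 fun s => ?_
  obtain ⟨N, hN⟩ := exists_forall_subset_box d s
  refine (Finset.sum_le_sum_of_subset_of_nonneg (hN N le_rfl) fun x _ _ => h0 x).trans ?_
  refine (Finset.sum_le_sum fun z _ => (hdec 0 z).2).trans ?_
  refine le_of_eq_of_le (Finset.sum_congr rfl fun z _ => ?_) (hB N)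
  rw [zero_sub, norm_neg, neg_mul]

/-! ### THE CENTRAL LIMIT THEOREMS IN THE PLUS PHASE -/

/-- **CENTRAL LIMIT THEOREM FOR THE ISING MAGNETISATION AT LOW TEMPERATURE** (Newman 1980, Thm. 2 and §1, with
Friedli–Velenik 2017, Thm. 5.16 — UNCONDITIONAL): for `d ≥ 2`, `β ≥ ltBeta d = 1 + log(2(6d+1)²)` and the plus state
`μ` at zero field (`∫ σ_A dμ = ⟨σ_A⟩⁺_{β,0}`; `exists_plusMeasure_holds`), with `M_n = Σ_{x∈Λ_n} σ_x` and
`m*(β) = spontaneousMagnetization d β`: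

`(M_n − |Λ_n| m*(β)) / √|Λ_n| → N(0, χ⁺(β))` in distribution, `χ⁺(β) = Σ_z (⟨σ_0σ_z⟩⁺_β − m*(β)²) = Σ_z ⟨σ_0;σ_z⟩⁺_β`

(for any `Y ~ gaussianReal 0 v`, `v = χ⁺(β)` as an `ℝ≥0`; `χ⁺ ≥ 1 − m*(β)²` by `one_sub_sq_le_tsum_plusTruncated`).
[cite: Newman1980, Thm. 2; Ellis2006, Thm. V.7.2; FriedliVelenik2017, Thm. 5.16] -/
theorem tendstoInDistribution_magnetization_plus_of_ltBeta_le {Ω' : Type*} {mΩ' : MeasurableSpace Ω'}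
    {P' : Measure Ω'} [IsProbabilityMeasure P'] {Y : Ω' → ℝ} (hd : 2 ≤ d) {β : ℝ} (hβ : LTContour.ltBeta d ≤ β)
    (μ : Measure (SpinConfig (Site d))) [IsProbabilityMeasure μ]
    (hμ : ∀ A : Finset (Site d), spinCorr μ A = plusCorr d β 0 A) {v : NNReal}
    (hv : (v : ℝ) = ∑' z : Site d, (plusCorr d β 0 ({0} ∆ {z}) - plusCorr d β 0 {0} * plusCorr d β 0 {z}))
    (hY : HasLaw Y (gaussianReal 0 v) P') :
    TendstoInDistribution (fun (n : ℕ) (σ : SpinConfig (Site d)) => (Real.sqrt #(box d n))⁻¹ *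
        (∑ z ∈ box d n, spinAt z σ - #(box d n) * spontaneousMagnetization d β)) atTop Y (fun _ => μ) P' := by
  have hβ0 : 0 ≤ β := by have := LTContour.one_le_ltBeta d; linarith
  rw [spontaneousMagnetization_eq_plusCorr]
  exact tendstoInDistribution_magnetization_plus_of_summable (le_trans one_le_two hd) hβ0 hμ
    (summable_plusTruncated_of_ltBeta_le hd hβ) hv hY

/-- **CENTRAL LIMIT THEOREM FOR THE ISING MAGNETISATION IN THE WHOLE ORDERED PHASE, `d ≥ 3` — CONDITIONAL on
Duminil-Copin–Goswami–Raoufi 2020, Thm. 1.1** (the tree's named fact, hypothesis `hDGR`): for `d ≥ 3`, `β > β_c(d)` and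
the plus state `μ` at zero field, `(M_n − |Λ_n| m*(β))/√|Λ_n| ⇒ N(0, χ⁺(β))`.
[cite: Newman1980, Thm. 2; DuminilCopinGoswamiRaoufi2020, Thm 1.1] -/
theorem tendstoInDistribution_magnetization_plus_of_criticalBeta_lt {Ω' : Type*} {mΩ' : MeasurableSpace Ω'}
    {P' : Measure Ω'} [IsProbabilityMeasure P'] {Y : Ω' → ℝ}
    (hDGR : DuminilCopinGoswamiRaoufi2020_truncatedTwoPointPlus_expDecay d) (hd : 3 ≤ d) {β : ℝ}
    (hβc : criticalBeta d < β) (μ : Measure (SpinConfig (Site d))) [IsProbabilityMeasure μ]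
    (hμ : ∀ A : Finset (Site d), spinCorr μ A = plusCorr d β 0 A) {v : NNReal}
    (hv : (v : ℝ) = ∑' z : Site d, (plusCorr d β 0 ({0} ∆ {z}) - plusCorr d β 0 {0} * plusCorr d β 0 {z}))
    (hY : HasLaw Y (gaussianReal 0 v) P') :
    TendstoInDistribution (fun (n : ℕ) (σ : SpinConfig (Site d)) => (Real.sqrt #(box d n))⁻¹ *
        (∑ z ∈ box d n, spinAt z σ - #(box d n) * spontaneousMagnetization d β)) atTop Y (fun _ => μ) P' := by
  have hβ0 : 0 ≤ β := (criticalBeta_nonneg (d := d)).trans hβc.le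
  rw [spontaneousMagnetization_eq_plusCorr]
  exact tendstoInDistribution_magnetization_plus_of_summable (by omega) hβ0 hμ
    (summable_plusTruncated_of_criticalBeta_lt hDGR hd hβc) hv hY

/-- **The low-temperature CLT with the plus state supplied** (non-vacuity): for `d ≥ 2`, `β ≥ ltBeta d` there is a
translation-invariant `μ ∈ 𝒢(β,0)` with the plus correlations under which `(M_n − |Λ_n| m*(β))/√|Λ_n| ⇒ N(0, χ⁺(β))`.
[cite: Newman1980, Thm. 2; FriedliVelenik2017, Thm. 3.17, Thm. 5.16, Thm. 6.26] -/
theorem exists_plusState_tendstoInDistribution_magnetization {Ω' : Type*} {mΩ' : MeasurableSpace Ω'}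
    {P' : Measure Ω'} [IsProbabilityMeasure P'] {Y : Ω' → ℝ} (hd : 2 ≤ d) {β : ℝ} (hβ : LTContour.ltBeta d ≤ β)
    {v : NNReal}
    (hv : (v : ℝ) = ∑' z : Site d, (plusCorr d β 0 ({0} ∆ {z}) - plusCorr d β 0 {0} * plusCorr d β 0 {z}))
    (hY : HasLaw Y (gaussianReal 0 v) P') :
    ∃ (μ : Measure (SpinConfig (Site d))) (_ : IsProbabilityMeasure μ), μ ∈ isingGibbsMeasures d β 0 ∧
      IsTranslationInvariantMeasure μ ∧ (∀ A : Finset (Site d), spinCorr μ A = plusCorr d β 0 A) ∧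
      TendstoInDistribution (fun (n : ℕ) (σ : SpinConfig (Site d)) => (Real.sqrt #(box d n))⁻¹ *
        (∑ z ∈ box d n, spinAt z σ - #(box d n) * spontaneousMagnetization d β)) atTop Y (fun _ => μ) P' := by
  have hβ0 : 0 ≤ β := by have := LTContour.one_le_ltBeta d; linarith
  obtain ⟨μ, hμG, hμT, hμc⟩ := exists_plusMeasure_holds (d := d) (β := β) (h := 0) hβ0
  haveI : IsProbabilityMeasure μ := ((mem_isingGibbsMeasures_iff d β 0 μ).1 hμG).isProbabilityMeasure
  exact ⟨μ, inferInstance, hμG, hμT, hμc,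
    tendstoInDistribution_magnetization_plus_of_ltBeta_le hd hβ μ hμc hv hY⟩

end IsingCLT

end Summit.CriticalPhenomena.PercolationContinuityZ3.Theorems.FK

end
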